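import Mathlib
import Literature.MathematicalPhysics.QuantumManyBody.BoseEinsteinCondensation
import Summits.AtomisticToContinuum.BoseEinsteinCondensation.Theorems.SoloBlindBhattacharyya
import Summits.AtomisticToContinuum.BoseEinsteinCondensation.Theorems.SoloBlindJensenAffinity
import Summits.AtomisticToContinuum.BoseEinsteinCondensation.Theorems.SoloBlindTrialStateCriterion

/-!
# `N · exp(−I(x₁ ; X̂)) ≤ λ_max`: the mutual-information Penrose–Onsager bound, hypothesis-free

Solo seat `solo-AtomisticToContinuum-blind`, conjunct `BoseEinsteinCondensation`.

The criteria of `SoloBlindJensenAffinity` / `SoloBlindTrialStateCriterion` carried a parametric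
integrability hypothesis (`∀ Y, Integrable (x ↦ g x · Φ(x :: Y))`) and an auxiliary mode `g`.  Here
both are removed:

* the integrability holds for almost every `Y` as soon as `∫ g² = 1` and `∫∫ Φ² = 1`
  (`ae_integrable_mul_vecCons`), which is all the occupation integral needs
  (`occupation_ofReal_eq_ae`, `bhattacharyya_sq_le_maxOccupation'`);
* choosing `g² = ρ₁`, the one-particle density of `|Φ|²`, the resampled law `g² ⊗ P̂` is the product
  of the two marginals of the Born law `𝐏` (`resampled_eq_prod_marginals`, via
  `MeasureTheory.prod_withDensity`), so `KL(𝐏 ‖ g² ⊗ P̂)` is the **one-vs-rest mutual information**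
  `I(x₁ ; X̂) = KL(𝐏 ‖ 𝐏₁ ⊗ P̂)` of the point process `|Φ|²`.

Main results: `mul_exp_neg_le_maxOccupation_of_mutualInfo_le` and its `TrialState` form
`TrialState.mul_exp_neg_le_maxOccupation_of_mutualInfo_le`: for a real nonnegative
`(n+1)`-boson trial state, `I(x₁ ; X̂) ≤ K` implies `(n+1) · e^{−K} ≤ maxOccupation (n+1) Ψ.ψ`.
In words: if one particle retains all but `K` nats of its positional information given the
positions of all the others, at least `e^{−K} (n+1)` particles occupy a single mode.
-/

open MeasureTheory InformationTheory
open scoped ENNReal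

namespace Summit.AtomisticToContinuum.BoseEinsteinCondensation.Theorems

open Literature.MathematicalPhysics.QuantumManyBody.BoseGas

section Integrability

/-- The product of two nonnegative square-integrable real functions is integrable. -/
theorem integrable_mul_of_lintegral_sq_ne_top {α : Type*} [MeasurableSpace α] (μ : Measure α)
    {g h : α → ℝ} (hg0 : 0 ≤ g) (hh0 : 0 ≤ h) (hgm : Measurable g) (hhm : Measurable h)
    (hg2 : ∫⁻ x, ENNReal.ofReal (g x) ^ 2 ∂μ ≠ ∞) (hh2 : ∫⁻ x, ENNReal.ofReal (h x) ^ 2 ∂μ ≠ ∞) :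
    Integrable (fun x => g x * h x) μ := by
  refine ⟨(hgm.mul hhm).aestronglyMeasurable, ?_⟩
  rw [hasFiniteIntegral_iff_enorm]
  -- `a · b ≤ a² + b²` in `ℝ≥0∞` (folklore; also `Literature.Analysis.FluidPDE.ennreal_mul_le_sq_add_sq`)
  have hmul : ∀ a b : ℝ≥0∞, a * b ≤ a ^ 2 + b ^ 2 := by
    intro a b
    rcases le_total a b with h | h
    · calc a * b ≤ b * b := mul_le_mul' h le_rfl
        _ = b ^ 2 := (sq b).symm
        _ ≤ a ^ 2 + b ^ 2 := le_add_self
    · calc a * b ≤ a * a := mul_le_mul' le_rfl h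
        _ = a ^ 2 := (sq a).symm
        _ ≤ a ^ 2 + b ^ 2 := le_self_add
  have hle : ∀ x, ‖g x * h x‖ₑ ≤ ENNReal.ofReal (g x) ^ 2 + ENNReal.ofReal (h x) ^ 2 := by
    intro x
    rw [Real.enorm_eq_ofReal (mul_nonneg (hg0 x) (hh0 x)), ENNReal.ofReal_mul (hg0 x)]
    exact hmul _ _
  calc ∫⁻ x, ‖g x * h x‖ₑ ∂μ
      ≤ ∫⁻ x, ENNReal.ofReal (g x) ^ 2 + ENNReal.ofReal (h x) ^ 2 ∂μ := lintegral_mono hle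
    _ = ∫⁻ x, ENNReal.ofReal (g x) ^ 2 ∂μ + ∫⁻ x, ENNReal.ofReal (h x) ^ 2 ∂μ :=
        lintegral_add_left (hgm.ennreal_ofReal.pow_const 2) _
    _ < ∞ := ENNReal.add_lt_top.mpr ⟨hg2.lt_top, hh2.lt_top⟩

/-- For a normalised mode `g` and a normalised amplitude `Φ`, `x ↦ g x · Φ(x :: Y)` is integrable
for almost every `Y`. -/
theorem ae_integrable_mul_vecCons {n : ℕ} {g : Space → ℝ} {Φ : Config (n + 1) → ℝ}
    (hg0 : 0 ≤ g) (hΦ0 : 0 ≤ Φ) (hgm : Measurable g) (hΦm : Measurable Φ)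
    (hg1 : ∫⁻ x, ENNReal.ofReal (g x) ^ 2 = 1)
    (hΦ1 : ∫⁻ Y : Config n, ∫⁻ x, ENNReal.ofReal (Φ (Matrix.vecCons x Y)) ^ 2 = 1) :
    ∀ᵐ Y : Config n, Integrable (fun x => g x * Φ (Matrix.vecCons x Y)) := by
  have hpm : Measurable fun z : Space × Config n =>
      ENNReal.ofReal (Φ (Matrix.vecCons z.1 z.2)) ^ 2 :=
    ((hΦm.comp measurable_vecCons).ennreal_ofReal).pow_const 2
  have hPhat : Measurable fun Y : Config n => ∫⁻ x, ENNReal.ofReal (Φ (Matrix.vecCons x Y)) ^ 2 :=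
    hpm.lintegral_prod_left'
  have hfin : ∀ᵐ Y : Config n, ∫⁻ x, ENNReal.ofReal (Φ (Matrix.vecCons x Y)) ^ 2 < ∞ :=
    ae_lt_top hPhat (by rw [hΦ1]; exact ENNReal.one_ne_top)
  filter_upwards [hfin] with Y hY
  have hmY : Measurable fun x : Space => Φ (Matrix.vecCons x Y) :=
    hΦm.comp (measurable_vecCons.comp (measurable_id.prodMk measurable_const))
  exact integrable_mul_of_lintegral_sq_ne_top volume hg0 (fun x => hΦ0 _) hgm hmY
    (by rw [hg1]; exact ENNReal.one_ne_top) hY.ne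

end Integrability

section BoseGas

/-- `occupation_ofReal_eq` under almost-everywhere integrability only. -/
theorem occupation_ofReal_eq_ae {n : ℕ} {g : Space → ℝ} {Φ : Config (n + 1) → ℝ}
    (hg0 : 0 ≤ g) (hΦ0 : 0 ≤ Φ)
    (hint : ∀ᵐ Y : Config n, Integrable (fun x => g x * Φ (Matrix.vecCons x Y))) :
    occupation (n + 1) (fun x => (g x : ℂ)) (fun X => (Φ X : ℂ)) =
      (n + 1 : ℝ≥0∞) * ∫⁻ Y : Config n,
        (∫⁻ x, ENNReal.ofReal (g x) * ENNReal.ofReal (Φ (Matrix.vecCons x Y))) ^ 2 := by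
  simp only [occupation]
  congr 1
  refine lintegral_congr_ae ?_
  filter_upwards [hint] with Y hY
  have hr : 0 ≤ ∫ x, g x * Φ (Matrix.vecCons x Y) :=
    integral_nonneg fun x => mul_nonneg (hg0 x) (hΦ0 _)
  have h1 : ∫ x, (starRingEnd ℂ) ((g x : ℂ)) * ((Φ (Matrix.vecCons x Y) : ℝ) : ℂ) =
      ((∫ x, g x * Φ (Matrix.vecCons x Y) : ℝ) : ℂ) := by
    have hfun : (fun x => (starRingEnd ℂ) ((g x : ℂ)) * ((Φ (Matrix.vecCons x Y) : ℝ) : ℂ)) =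
        fun x => ((g x * Φ (Matrix.vecCons x Y) : ℝ) : ℂ) := by
      ext x
      simp only [Complex.conj_ofReal, Complex.ofReal_mul]
    rw [hfun]
    exact integral_complex_ofReal
  rw [h1, coe_nnnorm_ofReal_of_nonneg hr,
    ofReal_integral_eq_lintegral_ofReal hY
      (ae_of_all _ fun x => mul_nonneg (hg0 x) (hΦ0 _))]
  congr 1
  refine lintegral_congr fun x => ?_
  rw [ENNReal.ofReal_mul (hg0 x)]

/-- `bhattacharyya_sq_le_maxOccupation` **without** the integrability hypothesis:
`(n+1) · BC(g² ⊗ P̂, |Φ|²)² ≤ maxOccupation (n+1) Φ` for every normalised `g, Φ ≥ 0`. -/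
theorem bhattacharyya_sq_le_maxOccupation' {n : ℕ} {g : Space → ℝ} {Φ : Config (n + 1) → ℝ}
    (hg0 : 0 ≤ g) (hΦ0 : 0 ≤ Φ) (hgm : Measurable g) (hΦm : Measurable Φ)
    (hg1 : ∫⁻ x, ENNReal.ofReal (g x) ^ 2 = 1)
    (hΦ1 : ∫⁻ Y : Config n, ∫⁻ x, ENNReal.ofReal (Φ (Matrix.vecCons x Y)) ^ 2 = 1) :
    (n + 1 : ℝ≥0∞) *
        (∫⁻ Y : Config n, (∫⁻ x, ENNReal.ofReal (g x) * ENNReal.ofReal (Φ (Matrix.vecCons x Y))) *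
          (∫⁻ x, ENNReal.ofReal (Φ (Matrix.vecCons x Y)) ^ 2) ^ (1 / 2 : ℝ)) ^ 2 ≤
      maxOccupation (n + 1) (fun X => (Φ X : ℂ)) := by
  have hint := ae_integrable_mul_vecCons hg0 hΦ0 hgm hΦm hg1 hΦ1
  have hΨ : Measurable (Function.uncurry fun (x : Space) (Y : Config n) =>
      ENNReal.ofReal (Φ (Matrix.vecCons x Y))) :=
    ENNReal.measurable_ofReal.comp (hΦm.comp measurable_vecCons)
  have hφ : Measurable fun x => ENNReal.ofReal (g x) := ENNReal.measurable_ofReal.comp hgm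
  have h := bhattacharyya_sandwich (volume : Measure Space) (volume : Measure (Config n))
    hΨ hφ hg1.le hΦ1
  have h1 : (n + 1 : ℝ≥0∞) *
        (∫⁻ Y : Config n, (∫⁻ x, ENNReal.ofReal (g x) * ENNReal.ofReal (Φ (Matrix.vecCons x Y))) *
          (∫⁻ x, ENNReal.ofReal (Φ (Matrix.vecCons x Y)) ^ 2) ^ (1 / 2 : ℝ)) ^ 2 ≤
      occupation (n + 1) (fun x => (g x : ℂ)) (fun X => (Φ X : ℂ)) := by
    rw [occupation_ofReal_eq_ae hg0 hΦ0 hint]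
    exact mul_le_mul' le_rfl h.1
  refine h1.trans (occupation_le_maxOccupation _ ?_ ?_)
  · exact (Complex.measurable_ofReal.comp hgm).aestronglyMeasurable
  · rw [← hg1]
    refine lintegral_congr fun x => ?_
    rw [coe_nnnorm_ofReal_of_nonneg (hg0 x)]

/-- `mul_exp_neg_le_maxOccupation_of_klDiv_symm_le` **without** the integrability hypothesis. -/
theorem mul_exp_neg_le_maxOccupation_of_klDiv_symm_le' {n : ℕ} {g : Space → ℝ}
    {Φ : Config (n + 1) → ℝ} (hg0 : 0 ≤ g) (hΦ0 : 0 ≤ Φ) (hgm : Measurable g) (hΦm : Measurable Φ)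
    (hg1 : ∫⁻ x, ENNReal.ofReal (g x) ^ 2 = 1)
    (hΦ1 : ∫⁻ Y : Config n, ∫⁻ x, ENNReal.ofReal (Φ (Matrix.vecCons x Y)) ^ 2 = 1)
    {K : ℝ} (hK0 : 0 ≤ K)
    (hK : klDiv
        (((volume : Measure Space).prod (volume : Measure (Config n))).withDensity
          fun z => ENNReal.ofReal (Φ (Matrix.vecCons z.1 z.2)) ^ 2)
        (((volume : Measure Space).prod (volume : Measure (Config n))).withDensity
          fun z => ENNReal.ofReal (g z.1) ^ 2 *
            ∫⁻ y, ENNReal.ofReal (Φ (Matrix.vecCons y z.2)) ^ 2) ≤ ENNReal.ofReal K) :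
    (n + 1 : ℝ≥0∞) * ENNReal.ofReal (Real.exp (-K)) ≤
      maxOccupation (n + 1) (fun X => (Φ X : ℂ)) := by
  have hpm : Measurable fun z : Space × Config n =>
      ENNReal.ofReal (Φ (Matrix.vecCons z.1 z.2)) ^ 2 :=
    ((hΦm.comp measurable_vecCons).ennreal_ofReal).pow_const 2
  have hPhat : Measurable fun c : Config n => ∫⁻ y, ENNReal.ofReal (Φ (Matrix.vecCons y c)) ^ 2 :=
    hpm.lintegral_prod_left'
  have hqm : Measurable fun z : Space × Config n =>
      ENNReal.ofReal (g z.1) ^ 2 * ∫⁻ y, ENNReal.ofReal (Φ (Matrix.vecCons y z.2)) ^ 2 :=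
    ((hgm.ennreal_ofReal.comp measurable_fst).pow_const 2).mul (hPhat.comp measurable_snd)
  have hp1 := lintegral_born_eq_one hΦm hΦ1
  have hq1 := lintegral_resampled_eq_one hgm hΦm hg1 hΦ1
  have hexp := exp_neg_div_two_le_lintegral_sqrt_of_klDiv_symm_le
    ((volume : Measure Space).prod (volume : Measure (Config n))) hpm hqm hp1 hq1 hK0 hK
  set Ψ : Space → Config n → ℝ≥0∞ := fun y c => ENNReal.ofReal (Φ (Matrix.vecCons y c)) with hΨ
  set φ : Space → ℝ≥0∞ := fun y => ENNReal.ofReal (g y) with hφ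
  have hΨm : Measurable (Function.uncurry Ψ) :=
    (hΦm.comp measurable_vecCons).ennreal_ofReal
  have hφm : Measurable φ := hgm.ennreal_ofReal
  have hid := lintegral_sqrt_densities_eq (volume : Measure Space) (volume : Measure (Config n))
    hΨm hφm
  have hb' : ENNReal.ofReal (Real.exp (-K / 2)) ≤
      ∫⁻ c, (∫⁻ y, φ y * Ψ y c) * (∫⁻ y, Ψ y c ^ 2) ^ (1 / 2 : ℝ) := by
    rw [← hid]
    exact hexp.trans (le_of_eq (lintegral_congr fun z => rfl))
  have hsand := bhattacharyya_sq_le_maxOccupation' hg0 hΦ0 hgm hΦm hg1 hΦ1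
  have hsq : ENNReal.ofReal (Real.exp (-K / 2)) ^ 2 = ENNReal.ofReal (Real.exp (-K)) := by
    rw [← ENNReal.ofReal_pow (Real.exp_pos _).le, sq, ← Real.exp_add]
    ring_nf
  rw [← hsq]
  exact le_trans (mul_le_mul' le_rfl (pow_le_pow_left' hb' 2)) hsand

end BoseGas

section MutualInformation

/-- With `g² = ρ₁`, the one-particle density of `|Φ|²`, the resampled law `g² ⊗ P̂` **is** the
product `𝐏₁ ⊗ P̂` of the two marginal laws of the Born law (both written through their densities). -/
theorem resampled_eq_prod_marginals {n : ℕ} {Φ : Config (n + 1) → ℝ} (hΦm : Measurable Φ)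
    (hΦ1 : ∫⁻ Y : Config n, ∫⁻ x, ENNReal.ofReal (Φ (Matrix.vecCons x Y)) ^ 2 = 1) :
    ((volume : Measure Space).prod (volume : Measure (Config n))).withDensity
        (fun z => ENNReal.ofReal (Real.sqrt
            (∫⁻ Y : Config n, ENNReal.ofReal (Φ (Matrix.vecCons z.1 Y)) ^ 2).toReal) ^ 2 *
          ∫⁻ y, ENNReal.ofReal (Φ (Matrix.vecCons y z.2)) ^ 2) =
      ((volume : Measure Space).withDensity
          fun x => ∫⁻ Y : Config n, ENNReal.ofReal (Φ (Matrix.vecCons x Y)) ^ 2).prod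
        ((volume : Measure (Config n)).withDensity
          fun Y => ∫⁻ x, ENNReal.ofReal (Φ (Matrix.vecCons x Y)) ^ 2) := by
  have hpm : Measurable fun z : Space × Config n =>
      ENNReal.ofReal (Φ (Matrix.vecCons z.1 z.2)) ^ 2 :=
    ((hΦm.comp measurable_vecCons).ennreal_ofReal).pow_const 2
  have hPhat : Measurable fun Y : Config n => ∫⁻ x, ENNReal.ofReal (Φ (Matrix.vecCons x Y)) ^ 2 :=
    hpm.lintegral_prod_left'
  have hρ : Measurable fun x : Space =>
      ∫⁻ Y : Config n, ENNReal.ofReal (Φ (Matrix.vecCons x Y)) ^ 2 :=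
    hpm.lintegral_prod_right'
  have hρ1 : ∫⁻ x : Space, ∫⁻ Y : Config n, ENNReal.ofReal (Φ (Matrix.vecCons x Y)) ^ 2 = 1 := by
    rw [lintegral_lintegral_swap hpm.aemeasurable]
    exact hΦ1
  have hρfin : ∀ᵐ x : Space, ∫⁻ Y : Config n, ENNReal.ofReal (Φ (Matrix.vecCons x Y)) ^ 2 < ∞ :=
    ae_lt_top hρ (by rw [hρ1]; exact ENNReal.one_ne_top)
  have hg2 : ∀ᵐ x : Space, ENNReal.ofReal (Real.sqrt
      (∫⁻ Y : Config n, ENNReal.ofReal (Φ (Matrix.vecCons x Y)) ^ 2).toReal) ^ 2 =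
      ∫⁻ Y : Config n, ENNReal.ofReal (Φ (Matrix.vecCons x Y)) ^ 2 := by
    filter_upwards [hρfin] with x hx
    rw [← ENNReal.ofReal_pow (Real.sqrt_nonneg _), Real.sq_sqrt ENNReal.toReal_nonneg,
      ENNReal.ofReal_toReal hx.ne]
  rw [prod_withDensity hρ hPhat]
  refine withDensity_congr_ae ?_
  filter_upwards [Measure.quasiMeasurePreserving_fst.ae hg2] with z hz
  rw [hz]

/-- **`(n+1) · e^{−I(x₁ ; X̂)} ≤ λ_max`, mutual-information form of the Penrose–Onsager bound.**
Let `Φ ≥ 0` be a measurable `(n+1)`-body amplitude with `∫∫ Φ(x :: Y)² dx dY = 1`, `𝐏` its Born law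
on `Space × Config n`, and `𝐏₁ ⊗ P̂` the product of its marginals (one particle / the rest), written
through their densities `ρ₁(x) = ∫ Φ(x :: Y)² dY`, `P̂(Y) = ∫ Φ(x :: Y)² dx`.  If the one-vs-rest
mutual information `I(x₁ ; X̂) = KL(𝐏 ‖ 𝐏₁ ⊗ P̂)` is `≤ K`, then
`(n+1) · e^{−K} ≤ maxOccupation (n+1) Φ`.  No further hypothesis. -/
theorem mul_exp_neg_le_maxOccupation_of_mutualInfo_le {n : ℕ} {Φ : Config (n + 1) → ℝ}
    (hΦ0 : 0 ≤ Φ) (hΦm : Measurable Φ)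
    (hΦ1 : ∫⁻ Y : Config n, ∫⁻ x, ENNReal.ofReal (Φ (Matrix.vecCons x Y)) ^ 2 = 1)
    {K : ℝ} (hK0 : 0 ≤ K)
    (hI : klDiv
        (((volume : Measure Space).prod (volume : Measure (Config n))).withDensity
          fun z => ENNReal.ofReal (Φ (Matrix.vecCons z.1 z.2)) ^ 2)
        (((volume : Measure Space).withDensity
            fun x => ∫⁻ Y : Config n, ENNReal.ofReal (Φ (Matrix.vecCons x Y)) ^ 2).prod
          ((volume : Measure (Config n)).withDensity
            fun Y => ∫⁻ x, ENNReal.ofReal (Φ (Matrix.vecCons x Y)) ^ 2)) ≤ ENNReal.ofReal K) :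
    (n + 1 : ℝ≥0∞) * ENNReal.ofReal (Real.exp (-K)) ≤
      maxOccupation (n + 1) (fun X => (Φ X : ℂ)) := by
  have hpm : Measurable fun z : Space × Config n =>
      ENNReal.ofReal (Φ (Matrix.vecCons z.1 z.2)) ^ 2 :=
    ((hΦm.comp measurable_vecCons).ennreal_ofReal).pow_const 2
  have hρ : Measurable fun x : Space =>
      ∫⁻ Y : Config n, ENNReal.ofReal (Φ (Matrix.vecCons x Y)) ^ 2 :=
    hpm.lintegral_prod_right'
  have hρ1 : ∫⁻ x : Space, ∫⁻ Y : Config n, ENNReal.ofReal (Φ (Matrix.vecCons x Y)) ^ 2 = 1 := by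
    rw [lintegral_lintegral_swap hpm.aemeasurable]
    exact hΦ1
  have hρfin : ∀ᵐ x : Space, ∫⁻ Y : Config n, ENNReal.ofReal (Φ (Matrix.vecCons x Y)) ^ 2 < ∞ :=
    ae_lt_top hρ (by rw [hρ1]; exact ENNReal.one_ne_top)
  set g : Space → ℝ := fun x =>
    Real.sqrt (∫⁻ Y : Config n, ENNReal.ofReal (Φ (Matrix.vecCons x Y)) ^ 2).toReal with hg
  have hg0 : 0 ≤ g := fun x => Real.sqrt_nonneg _
  have hgm : Measurable g := hρ.ennreal_toReal.sqrt
  have hg2 : ∀ᵐ x : Space, ENNReal.ofReal (g x) ^ 2 =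
      ∫⁻ Y : Config n, ENNReal.ofReal (Φ (Matrix.vecCons x Y)) ^ 2 := by
    filter_upwards [hρfin] with x hx
    rw [hg, ← ENNReal.ofReal_pow (Real.sqrt_nonneg _), Real.sq_sqrt ENNReal.toReal_nonneg,
      ENNReal.ofReal_toReal hx.ne]
  have hg1 : ∫⁻ x, ENNReal.ofReal (g x) ^ 2 = 1 := by
    rw [lintegral_congr_ae hg2, hρ1]
  rw [← resampled_eq_prod_marginals hΦm hΦ1] at hI
  exact mul_exp_neg_le_maxOccupation_of_klDiv_symm_le' hg0 hΦ0 hgm hΦm hg1 hΦ1 hK0 hI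

namespace TrialState

/-- **`TrialState` form.**  For a real nonnegative `(n+1)`-boson trial state `Ψ` (`Ψ.ψ = Φ ≥ 0`):
if the one-vs-rest mutual information of `|Φ|²` is `≤ K` then
`(n+1) · e^{−K} ≤ maxOccupation (n+1) Ψ.ψ`: a particle that keeps all but `K` nats of its positional
information, given the positions of all the others, forces a mode occupied by `≥ e^{−K} (n+1)`
particles.  An `N`-uniform bound `I(x₁ ; X̂) ≤ K` along (near-)minimisers at fixed small density
would, with `BoseGas.le_condensateNumber`, give `HasGroundStateBEC`; that bound is the open problem. -/
theorem mul_exp_neg_le_maxOccupation_of_mutualInfo_le {n : ℕ} {L : ℝ}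
    (Ψ : TrialState (n + 1) L) {Φ : Config (n + 1) → ℝ} (hΦ0 : 0 ≤ Φ)
    (hΨΦ : Ψ.ψ = fun X => (Φ X : ℂ)) {K : ℝ} (hK0 : 0 ≤ K)
    (hI : klDiv
        (((volume : Measure Space).prod (volume : Measure (Config n))).withDensity
          fun z => ENNReal.ofReal (Φ (Matrix.vecCons z.1 z.2)) ^ 2)
        (((volume : Measure Space).withDensity
            fun x => ∫⁻ Y : Config n, ENNReal.ofReal (Φ (Matrix.vecCons x Y)) ^ 2).prod
          ((volume : Measure (Config n)).withDensity
            fun Y => ∫⁻ x, ENNReal.ofReal (Φ (Matrix.vecCons x Y)) ^ 2)) ≤ ENNReal.ofReal K) :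
    (n + 1 : ℝ≥0∞) * ENNReal.ofReal (Real.exp (-K)) ≤ maxOccupation (n + 1) Ψ.ψ := by
  rw [hΨΦ]
  exact Theorems.mul_exp_neg_le_maxOccupation_of_mutualInfo_le hΦ0 (measurable_of_eq_ofReal Ψ hΨΦ)
    (lintegral_lintegral_sq_eq_one Ψ hΦ0 hΨΦ) hK0 hI

end TrialState

end MutualInformation

end Summit.AtomisticToContinuum.BoseEinsteinCondensation.Theorems
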